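import Literature.Analysis.FluidPDE.OnsagerBDSVPerturbationSmooth
import Literature.Analysis.FluidPDE.OnsagerBDSVBiotSavart
import Literature.Analysis.FluidPDE.OnsagerBDSVParameters
import HarnessLib

/-!
# The BDSV perturbation: the new triple solves the Euler–Reynolds system (§5.4) — discharge of F₅

Buckmaster–De Lellis–Székelyhidi–Vicol 2019, §5.4: "With this definition [(5.23),
`R̊_{q+1} = ℛ(w·∇v̄_q) + ℛ(∂ₜw + v̄_q·∇w) + ℛ div(w ⊗ w - R̄_q)`] and Proposition 4.1, one may
verify that `∂ₜv_{q+1} + div(v_{q+1} ⊗ v_{q+1}) + ∇p_{q+1} = div R̊_{q+1}`, `div v_{q+1} = 0`."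
This file PROVES the verification for the construction of `OnsagerBDSVPerturbation.lean` and
DISCHARGES the named fact `BDSV.newTriple_isEulerReynolds` (F₅ of the decomposition of
`BDSV.perturbationStage`): `BDSV.newTriple_isEulerReynolds_holds`.

* Vector calculus on `T³` (all proved; `div curl = 0` is `BDSV.divergence_curl` of
  `OnsagerBDSVBiotSavart.lean`): `∫ curl = 0` (`BDSV.integral_curl`), the product rule `div(v ⊗ u) = (u·∇)v + (div u) v`
  (`BDSV.tensorDivergence_smul`), `div(ρ Id) = ∇ρ` (`BDSV.tensorDivergence_smul_single`),
  linearity and `∫ div σ = 0` for tensor fields, `(u·∇)v + (v·∇)u = div(v ⊗ u + u ⊗ v)` and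
  `∫ ((u·∇)v + (v·∇)u) = 0` for divergence-free fields, `div`/`∫` of the perturbation
  (`SmoothData.isDivFree_perturbation`, `SmoothData.integral_perturbation`,
  `SmoothData.integral_timeDerivWithin_perturbation`). (Twins of the product rule, of
  `div(ρ Id) = ∇ρ` and of the additivity lemmas exist in `NavierStokesConcentrationTools.lean` as
  `Torus.tensorDivergence_tensorProd`, `Torus.tensorDivergence_smul_single`,
  `Torus.divergence_add_apply`, `Torus.tensorDivergence_add_apply`; that module is not imported:
  its closure brings `VectorCalculus.lean`, whose `ℝ³` operators `convect`, `divergence`, `curl`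
  in `Literature.Analysis.FluidPDE` shadow the bare torus operators used throughout the BDSV
  files.)
* The cut-off support identity `(∑_i η_i²) R̊̄_q = R̊̄_q` on `[0,T]` from (2.17), (ii), (iii)
  (`BDSV.sum_eta_sq_smul_Rbar`).
* §5.4 proper: `⨍F = 0` (`SmoothData.integral_stressSource`: `∂ₜw` integrates to the derivative
  of `∫w = 0`, the Nash/transport pair to `∫div = 0`, the oscillation term is a divergence), hence
  `div R̊_{q+1} = F` (Prop. 4.1 = `Torus.tensorDivergence_antidivergence`); `∫ p_{q+1} = 0`
  (`SmoothData.hasZeroMean_newPressure`); the momentum identity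
  (`SmoothData.momentum_newTriple`: expand `v_{q+1} = v̄_q + w`, use the Euler–Reynolds equation
  of the glued triple, `div(w ⊗ w) = (w·∇)w`, `div(ρId) = ∇ρ` and the support identity); and
  `SmoothData.isEulerReynoldsOn_newTriple`.
* The discharge `BDSV.newTriple_isEulerReynolds_holds`, with `α₀ = βb(b-1)`, `N̄ = 0` and the
  threshold `a₀` of `BDSV.exists_threshold_amp_succ_succ` (`2δ_{q+2} ≤ δ_{q+1}λ_q^{-α}` for
  `α < 2βb(b-1)`, from the master parameter lemma `BDSV.exists_freq_triple_le`), which with the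
  energy gap (5.2) gives `ρ_q ≥ δ_{q+2}/6 > 0` (Lemma 5.4 (5.15)); `∑∫η_j² ≥ c₀ > 0` is (v).

## References

* T. Buckmaster, C. De Lellis, L. Székelyhidi Jr., V. Vicol, *Onsager's conjecture for admissible
  weak solutions*, Comm. Pure Appl. Math. 72 (2019) = arXiv:1701.08678, §5.2 (properties (ii),
  (iii), (2.17)), §5.4 (5.23)–(5.24), Prop. 4.1, Lemma 5.4 (5.15).
-/

open MeasureTheory Set
open scoped NNReal ENNReal ContDiff Matrix Matrix.Norms.Elementwise

noncomputable section

namespace Literature.Analysis.FluidPDE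

namespace BDSV

open FunctionSpaces FunctionSpaces.Torus

/-- The flat three-torus `T³ = (ℝ/ℤ)³`, local notation. -/
local notation "𝕋³" => UnitAddTorus (Fin 3)

/-- Euclidean `ℝ³`, local notation. -/
local notation "ℝ³" => EuclideanSpace ℝ (Fin 3)

/-! ## Vector-calculus identities on `T³` used in §5.4 -/

section Calculus

open Torus

/-- `IsSmooth` functions are `C¹`. [folklore] -/
theorem _root_.Literature.Analysis.FunctionSpaces.Torus.IsSmooth.isContDiff_one {d : Type*} [Fintype d]
    {F : Type*} [NormedAddCommGroup F] [NormedSpace ℝ F] {f : UnitAddTorus d → F} (hf : IsSmooth f) :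
    IsContDiff 1 f :=
  hf.isContDiff (by simp)

/-- Components of integrals of `ℝ³`-valued functions. [folklore] -/
theorem integral_apply_eq {f : 𝕋³ → ℝ³} (hf : Integrable f volume) (i : Fin 3) :
    (∫ x, f x) i = ∫ x, f x i :=
  ((EuclideanSpace.proj i : ℝ³ →L[ℝ] ℝ).integral_comp_comm hf).symm

/-- **`∫ curl = 0`** on `T³` for smooth fields. [folklore] -/
theorem integral_curl {Z : 𝕋³ → ℝ³} (hZ : IsSmooth Z) : ∫ x, curl Z x = 0 := by
  have hcurl : IsSmooth (curl Z) := isSmooth_curl hZ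
  have hint : ∀ j k : Fin 3, ∫ y, partialDeriv j Z y k = 0 := fun j k => by
    have h := integral_partialDeriv_eq_zero_holds (hZ.apply k) j
    simp_rw [partialDeriv_apply_coord hZ.isContDiff_one] at h
    exact h
  have hI : ∀ j k : Fin 3, Integrable (fun y => partialDeriv j Z y k) volume := fun j k =>
    ((hZ.partialDeriv j).apply k).integrable
  ext i
  rw [integral_apply_eq hcurl.integrable, PiLp.zero_apply]
  fin_cases i
  · show ∫ y, (partialDeriv 1 Z y 2 - partialDeriv 2 Z y 1) = 0
    rw [integral_sub (hI 1 2) (hI 2 1), hint, hint, sub_zero]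
  · show ∫ y, (partialDeriv 2 Z y 0 - partialDeriv 0 Z y 2) = 0
    rw [integral_sub (hI 2 0) (hI 0 2), hint, hint, sub_zero]
  · show ∫ y, (partialDeriv 0 Z y 1 - partialDeriv 1 Z y 0) = 0
    rw [integral_sub (hI 0 1) (hI 1 0), hint, hint, sub_zero]

/-- **Product rule for the tensor divergence**: `div (v ⊗ u) = (u·∇)v + (div u) v`, where
`v ⊗ u` has columns `u_j v`. [folklore] -/
theorem tensorDivergence_smul {u : 𝕋³ → ℝ³} {v : 𝕋³ → ℝ³} (hu : IsSmooth u) (hv : IsSmooth v)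
    (x : 𝕋³) :
    Torus.tensorDivergence (fun y j => u y j • v y) x = convect u v x + divergence u x • v x := by
  rw [Torus.tensorDivergence, convect_eq_sum_smul_partialDeriv hv.isContDiff_one, divergence,
    Finset.sum_smul, ← Finset.sum_add_distrib]
  refine Finset.sum_congr rfl fun j _ => ?_
  exact partialDeriv_smul (hu.apply j).isContDiff_one hv.isContDiff_one j x

/-- `div (ρ Id) = ∇ρ`: the tensor with columns `ρ e_j` has divergence `∇ρ`. [folklore] -/
theorem tensorDivergence_smul_single {ρ : 𝕋³ → ℝ} (hρ : IsSmooth ρ) (x : 𝕋³) :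
    Torus.tensorDivergence (fun y j => ρ y • EuclideanSpace.single j (1 : ℝ)) x = gradient ρ x := by
  rw [Torus.tensorDivergence, gradient_eq_sum_partialDeriv hρ.isContDiff_one]
  refine Finset.sum_congr rfl fun j _ => ?_
  rw [partialDeriv_smul hρ.isContDiff_one (isSmooth_const _).isContDiff_one, partialDeriv_const_apply,
    smul_zero, zero_add]

/-- Linearity of the tensor divergence (difference of smooth tensor fields). [folklore] -/
theorem tensorDivergence_sub {A B : 𝕋³ → Fin 3 → ℝ³} (hA : IsSmooth A) (hB : IsSmooth B) (x : 𝕋³) :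
    Torus.tensorDivergence (fun y j => A y j - B y j) x =
      Torus.tensorDivergence A x - Torus.tensorDivergence B x := by
  rw [Torus.tensorDivergence, Torus.tensorDivergence, Torus.tensorDivergence, ← Finset.sum_sub_distrib]
  refine Finset.sum_congr rfl fun j _ => ?_
  exact partialDeriv_sub_at (hA.column j).isContDiff_one (hB.column j).isContDiff_one j x

/-- Linearity of the tensor divergence (sum of smooth tensor fields). [folklore] -/
theorem tensorDivergence_add {A B : 𝕋³ → Fin 3 → ℝ³} (hA : IsSmooth A) (hB : IsSmooth B) (x : 𝕋³) :
    Torus.tensorDivergence (fun y j => A y j + B y j) x =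
      Torus.tensorDivergence A x + Torus.tensorDivergence B x := by
  rw [Torus.tensorDivergence, Torus.tensorDivergence, Torus.tensorDivergence, ← Finset.sum_add_distrib]
  refine Finset.sum_congr rfl fun j _ => ?_
  exact partialDeriv_add_apply (hA.column j).isContDiff_one (hB.column j).isContDiff_one j x

/-- `∫ div σ = 0` for smooth tensor fields on `T³`. [folklore] -/
theorem integral_tensorDivergence {σ : 𝕋³ → Fin 3 → ℝ³} (hσ : IsSmooth σ) :
    ∫ x, Torus.tensorDivergence σ x = 0 := by
  unfold Torus.tensorDivergence
  rw [integral_finsetSum _ fun j _ => ((hσ.column j).partialDeriv j).integrable]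
  exact Finset.sum_eq_zero fun j _ => integral_partialDeriv_eq_zero_holds (hσ.column j) j

/-- For divergence-free smooth `u, v`: `(u·∇)v + (v·∇)u = div (v ⊗ u + u ⊗ v)`. [folklore] -/
theorem convect_add_convect_eq {u v : 𝕋³ → ℝ³} (hu : IsSmooth u) (hv : IsSmooth v)
    (hdu : IsDivFree u) (hdv : IsDivFree v) (x : 𝕋³) :
    convect u v x + convect v u x =
      Torus.tensorDivergence (fun y j => u y j • v y + v y j • u y) x := by
  have hA : IsSmooth (fun y j => u y j • v y) :=
    contDiff_pi.2 fun j => (hu.apply j).smul' hv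
  have hB : IsSmooth (fun y j => v y j • u y) :=
    contDiff_pi.2 fun j => (hv.apply j).smul' hu
  rw [tensorDivergence_add hA hB, tensorDivergence_smul hu hv, tensorDivergence_smul hv hu, hdu x, hdv x,
    zero_smul, zero_smul, add_zero, add_zero]

/-- For divergence-free smooth `u, v`: `∫ ((u·∇)v + (v·∇)u) = 0`. [folklore] -/
theorem integral_convect_add_convect {u v : 𝕋³ → ℝ³} (hu : IsSmooth u) (hv : IsSmooth v)
    (hdu : IsDivFree u) (hdv : IsDivFree v) :
    ∫ x, (convect u v x + convect v u x) = 0 := by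
  have hA : IsSmooth (fun y j => u y j • v y + v y j • u y) :=
    contDiff_pi.2 fun j => ((hu.apply j).smul' hv).add ((hv.apply j).smul' hu)
  simp_rw [convect_add_convect_eq hu hv hdu hdv]
  exact integral_tensorDivergence hA

/-- For divergence-free smooth `w`: `div (w ⊗ w) = (w·∇)w`. [folklore] -/
theorem tensorDivergence_smul_self {w : 𝕋³ → ℝ³} (hw : IsSmooth w) (hdw : IsDivFree w) (x : 𝕋³) :
    Torus.tensorDivergence (fun y j => w y j • w y) x = convect w w x := by
  rw [tensorDivergence_smul hw hw, hdw x, zero_smul, add_zero]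

end Calculus

/-! ## Divergence identities and the cut-off support identity -/

section MoreCalculus

open Torus

/-- Additivity of the divergence for smooth fields. [folklore] -/
theorem divergence_add {u v : 𝕋³ → ℝ³} (hu : IsSmooth u) (hv : IsSmooth v) (x : 𝕋³) :
    divergence (fun y => u y + v y) x = divergence u x + divergence v x := by
  rw [divergence, divergence, divergence, ← Finset.sum_add_distrib]
  refine Finset.sum_congr rfl fun i _ => ?_
  exact partialDeriv_add_apply (hu.apply i).isContDiff_one (hv.apply i).isContDiff_one i x

variable {P : Params} {S : Setting} {η : ℕ → ℝ → 𝕋³ → ℝ} {D : ℕ → ℝ → 𝕋³ → ℝ³}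

/-- The perturbation is divergence free: `div w_{q+1} = n⁻¹ div curl Z = 0`. [folklore] -/
theorem SmoothData.isDivFree_perturbation (h : SmoothData P S η D) (𝔚 : MikadoDatum mikadoRadius)
    {t : ℝ} (ht : t ∈ Icc 0 S.T) : IsDivFree (BDSV.perturbation P S 𝔚 η D t) := fun x => by
  have hZ : IsSmooth (BDSV.potential P S 𝔚 η D t) := (h.potential 𝔚).isSmooth_slice ht
  have hc : IsSmooth (curl (BDSV.potential P S 𝔚 η D t)) :=
    ((h.potential 𝔚).curl h.uniqueDiffOn).isSmooth_slice ht
  show divergence (((P.freqNat (S.q + 1) : ℝ))⁻¹ • curl (BDSV.potential P S 𝔚 η D t)) x = 0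
  rw [Torus.divergence_const_smul hc.isContDiff_one, divergence_curl hZ, mul_zero]

/-- The perturbation has zero mean: `∫ w_{q+1} = n⁻¹ ∫ curl Z = 0`. [folklore] -/
theorem SmoothData.integral_perturbation (h : SmoothData P S η D) (𝔚 : MikadoDatum mikadoRadius)
    {t : ℝ} (ht : t ∈ Icc 0 S.T) : ∫ x, BDSV.perturbation P S 𝔚 η D t x = 0 := by
  have hZ : IsSmooth (BDSV.potential P S 𝔚 η D t) := (h.potential 𝔚).isSmooth_slice ht
  show ∫ x, ((P.freqNat (S.q + 1) : ℝ))⁻¹ • curl (BDSV.potential P S 𝔚 η D t) x = 0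
  rw [integral_smul, integral_curl hZ, smul_zero]

/-- `∫ ∂ₜ w_{q+1} = 0`: the time derivative of the (vanishing) mean of the perturbation. [folklore] -/
theorem SmoothData.integral_timeDerivWithin_perturbation (h : SmoothData P S η D)
    (𝔚 : MikadoDatum mikadoRadius) {t : ℝ} (ht : t ∈ Icc 0 S.T) :
    ∫ x, timeDerivWithin (Icc 0 S.T) (BDSV.perturbation P S 𝔚 η D) t x = 0 := by
  have h1 := (h.perturbation 𝔚).hasDerivWithinAt_integral (convex_Icc 0 S.T) ht
  have h2 : HasDerivWithinAt (fun s => ∫ x, BDSV.perturbation P S 𝔚 η D s x) 0 (Icc 0 S.T) t :=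
    (hasDerivWithinAt_const t (Icc 0 S.T) (0 : ℝ³)).congr_of_mem
      (fun s hs => h.integral_perturbation 𝔚 hs) ht
  exact (h.uniqueDiffOn t ht).eq_deriv _ h1 h2

/-- The columns of `R̄_q` in closed form: `R̄_q e_j = (∑_i ρ_{q,i}) e_j - (∑_i η_i²) R̊̄_q e_j`. [folklore] -/
theorem stressSum_apply (t : ℝ) (y : 𝕋³) (j : Fin 3) :
    BDSV.stressSum P S η t y j =
      (∑ i ∈ Finset.range (cutoffCount S.T (P.τ S.q)), BDSV.rhoI P S η i t y) •
          EuclideanSpace.single j (1 : ℝ) -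
        (∑ i ∈ Finset.range (cutoffCount S.T (P.τ S.q)), η i t y ^ 2) • S.Rbar t y j := by
  rw [BDSV.stressSum, Finset.sum_sub_distrib, Finset.sum_smul, Finset.sum_smul]

/-- **The cut-off support identity** `(∑_i η_i²) R̊̄_q = R̊̄_q` on `[0,T]`: on `I_n ∩ [0,T]` the
cut-off `η_n` is `1` and the others vanish, and off `⋃ I_n` the stress vanishes ((2.17), (ii),
(iii)). [cite: BuckmasterEtAl2018, §5.2 (properties of R_{q,i})] -/
theorem sum_eta_sq_smul_Rbar {T τ c₀ : ℝ} {Cη : ℕ → ℕ → ℝ} (hτ : 0 < τ) (cut : CutoffFamily T τ c₀ Cη)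
    {R : ℝ → 𝕋³ → Fin 3 → ℝ³} (hR : SupportedOnGlueIntervals T τ R) {t : ℝ} (ht : t ∈ Icc 0 T)
    (x : 𝕋³) (j : Fin 3) :
    (∑ i ∈ Finset.range (cutoffCount T τ), cut.η i t x ^ 2) • R t x j = R t x j := by
  by_cases hI : ∃ n : ℕ, t ∈ Icc ((n : ℝ) * τ + τ / 3) ((n : ℝ) * τ + 2 * τ / 3)
  · obtain ⟨n, hn⟩ := hI
    have hηn : cut.η n t x = 1 := cut.eq_one n t ht hn x
    have hother : ∀ i, i ≠ n → cut.η i t x = 0 := fun i hi => by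
      rcases cut.disjoint i n hi t x with h | h
      · exact h
      · rw [hηn] at h; exact absurd h one_ne_zero
    have hnN : n ∈ Finset.range (cutoffCount T τ) := by
      rw [Finset.mem_range, cutoffCount]
      by_contra hcon
      push Not at hcon
      have h1 : (⌈T / τ⌉₊ : ℝ) + 2 ≤ n := by exact_mod_cast hcon
      have h2 : T / τ ≤ ⌈T / τ⌉₊ := Nat.le_ceil _
      have h3 : T / τ * τ = T := div_mul_cancel₀ T hτ.ne'
      have h4 : t ≤ T := ht.2
      have h5 : (n : ℝ) * τ + τ / 3 ≤ t := hn.1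
      nlinarith
    rw [Finset.sum_eq_single n (fun i _ hi => by rw [hother i hi]; ring) (fun h => absurd hnN h), hηn,
      one_pow, one_smul]
  · push Not at hI
    rw [hR t ht (fun n hn => hI n hn) x]
    simp

end MoreCalculus

/-! ## The new triple solves the Euler–Reynolds system (§5.4) -/

section EulerReynolds

open Torus

variable {P : Params} {S : Setting} {η : ℕ → ℝ → 𝕋³ → ℝ} {D : ℕ → ℝ → 𝕋³ → ℝ³}

namespace SmoothData

variable (h : SmoothData P S η D) (𝔚 : MikadoDatum mikadoRadius)
include h

/-- The source `F` of (5.23) has zero mean on every time slice (`∂ₜw` and `div`/curl terms).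
[cite: BuckmasterEtAl2018, §5.4 (all three terms of (5.23) have zero mean)] -/
theorem integral_stressSource (hdiv : ∀ t ∈ Icc 0 S.T, IsDivFree (S.vbar t)) {t : ℝ}
    (ht : t ∈ Icc 0 S.T) : ∫ x, BDSV.stressSource P S 𝔚 η D t x = 0 := by
  have hw := h.perturbation 𝔚
  have hwt : IsSmooth (BDSV.perturbation P S 𝔚 η D t) := hw.isSmooth_slice ht
  have hvt : IsSmooth (S.vbar t) := h.vbar.isSmooth_slice ht
  have hosc := (h.oscillationTensor 𝔚).isSmooth_slice ht
  have i1 : Integrable (fun x => timeDerivWithin (Icc 0 S.T) (BDSV.perturbation P S 𝔚 η D) t x)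
      volume := (hw.isSmooth_timeDerivWithin h.uniqueDiffOn ht).integrable
  have i2 : Integrable (fun x => convect (S.vbar t) (BDSV.perturbation P S 𝔚 η D t) x) volume :=
    (hvt.convect hwt).integrable
  have i3 : Integrable (fun x => convect (BDSV.perturbation P S 𝔚 η D t) (S.vbar t) x) volume :=
    (hwt.convect hvt).integrable
  have i4 : Integrable (fun x => Torus.tensorDivergence (fun y j => BDSV.perturbation P S 𝔚 η D t y j •
      BDSV.perturbation P S 𝔚 η D t y - BDSV.stressSum P S η t y j) x) volume :=
    hosc.tensorDivergence.integrable
  have i12 : Integrable (fun x => timeDerivWithin (Icc 0 S.T) (BDSV.perturbation P S 𝔚 η D) t x +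
      convect (S.vbar t) (BDSV.perturbation P S 𝔚 η D t) x) volume := i1.add i2
  have i123 : Integrable (fun x => timeDerivWithin (Icc 0 S.T) (BDSV.perturbation P S 𝔚 η D) t x +
      convect (S.vbar t) (BDSV.perturbation P S 𝔚 η D t) x +
      convect (BDSV.perturbation P S 𝔚 η D t) (S.vbar t) x) volume := i12.add i3
  have e1 := h.integral_timeDerivWithin_perturbation 𝔚 ht
  have e23 := integral_convect_add_convect hvt hwt (hdiv t ht) (h.isDivFree_perturbation 𝔚 ht)
  have e4 := integral_tensorDivergence hosc
  unfold BDSV.stressSource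
  rw [integral_add i123 i4, integral_add i12 i3, integral_add i1 i2, e1, e4,
    zero_add, add_zero, ← integral_add i2 i3]
  exact e23

/-- `div R̊_{q+1} = F` on `[0,T]` (Prop. 4.1: `div ℛF = F - ⨍F`, and `⨍F = 0`).
[cite: BuckmasterEtAl2018, Prop. 4.1 and §5.4] -/
theorem tensorDivergence_newStress (hdiv : ∀ t ∈ Icc 0 S.T, IsDivFree (S.vbar t)) {t : ℝ}
    (ht : t ∈ Icc 0 S.T) (x : 𝕋³) :
    Torus.tensorDivergence (BDSV.newStress P S 𝔚 η D t) x = BDSV.stressSource P S 𝔚 η D t x := by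
  rw [BDSV.newStress, Torus.tensorDivergence_antidivergence (by simp) ((h.stressSource 𝔚).isSmooth_slice ht),
    h.integral_stressSource 𝔚 hdiv ht, sub_zero]

/-- The mean of the new pressure vanishes: `∫ p_{q+1} = ∫ p̄_q + ρ_q - ∑_i ∫ρ_{q,i} = 0`.
[cite: BuckmasterEtAl2018, §5.4 (5.24)] -/
theorem hasZeroMean_newPressure (hp : ∀ t ∈ Icc 0 S.T, HasZeroMean (S.pbar t)) {t : ℝ}
    (ht : t ∈ Icc 0 S.T) : HasZeroMean (BDSV.newPressure P S η t) := by
  have hm : etaMass P S η t ≠ 0 := (h.mass_pos t ht).ne'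
  have ipbar : Integrable (S.pbar t) volume := (h.pbar.isSmooth_slice ht).integrable
  have irho : ∀ i, Integrable (BDSV.rhoI P S η i t) volume := fun i =>
    ((h.rhoI i).isSmooth_slice ht).integrable
  have hint : ∀ i, ∫ x, BDSV.rhoI P S η i t x =
      (∫ x, η i t x ^ 2) * (rhoQ P S t / etaMass P S η t) := fun i => by
    unfold BDSV.rhoI
    exact integral_mul_const _ _
  have ic : Integrable (fun _ : 𝕋³ => rhoQ P S t) volume := integrable_const _
  have ipc : Integrable (fun x => S.pbar t x + rhoQ P S t) volume := ipbar.add ic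
  have isum : Integrable (fun x => ∑ i ∈ Finset.range (cutoffCount S.T (P.τ S.q)), BDSV.rhoI P S η i t x)
      volume := integrable_finsetSum _ fun i _ => irho i
  unfold HasZeroMean BDSV.newPressure
  rw [integral_sub ipc isum, integral_add ipbar ic, integral_finsetSum _ fun i _ => irho i, hp t ht]
  simp_rw [hint]
  rw [← Finset.sum_mul, integral_const, ← etaMass]
  simp only [probReal_univ, one_smul, zero_add]
  field_simp
  ring

/-- **The momentum equation for the new triple** on `[0,T] × T³`:
`∂ₜv_{q+1} + (v_{q+1}·∇)v_{q+1} + ∇p_{q+1} = div R̊_{q+1}`. The verification of §5.4: expand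
`v_{q+1} = v̄_q + w`, use the Euler–Reynolds equation of `(v̄_q, p̄_q, R̊̄_q)`, `div ℛF = F`,
`div(w ⊗ w) = (w·∇)w` (`div w = 0`), `div(ρ Id) = ∇ρ` and `(∑_i η_i²)R̊̄_q = R̊̄_q`.
[cite: BuckmasterEtAl2018, §5.4 (5.23)–(5.24)] -/
theorem momentum_newTriple (hER : Torus.IsEulerReynoldsOn (Icc 0 S.T) S.vbar S.pbar S.Rbar)
    (hsupp : ∀ t ∈ Icc 0 S.T, ∀ (x : 𝕋³) (j : Fin 3),
      (∑ i ∈ Finset.range (cutoffCount S.T (P.τ S.q)), η i t x ^ 2) • S.Rbar t x j = S.Rbar t x j)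
    {t : ℝ} (ht : t ∈ Icc 0 S.T) (x : 𝕋³) :
    timeDerivWithin (Icc 0 S.T) (BDSV.newVelocity P S 𝔚 η D) t x +
      convect (BDSV.newVelocity P S 𝔚 η D t) (BDSV.newVelocity P S 𝔚 η D t) x +
      gradient (BDSV.newPressure P S η t) x =
    Torus.tensorDivergence (BDSV.newStress P S 𝔚 η D t) x := by
  -- abbreviations and smoothness
  set w := BDSV.perturbation P S 𝔚 η D with hwdef
  set v := S.vbar with hvdef
  set ρtot : 𝕋³ → ℝ := fun y => ∑ i ∈ Finset.range (cutoffCount S.T (P.τ S.q)), BDSV.rhoI P S η i t y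
    with hρtot
  have hw := h.perturbation 𝔚
  have hwt : IsSmooth (w t) := hw.isSmooth_slice ht
  have hvt : IsSmooth (v t) := h.vbar.isSmooth_slice ht
  have hpt : IsSmooth (S.pbar t) := h.pbar.isSmooth_slice ht
  have hRt : IsSmooth (S.Rbar t) := h.Rbar.isSmooth_slice ht
  have hρi : ∀ i, IsSmooth (BDSV.rhoI P S η i t) := fun i => (h.rhoI i).isSmooth_slice ht
  have hρtot : IsSmooth ρtot := isSmooth_finset_sum _ fun i _ => hρi i
  have hdivw : IsDivFree (w t) := h.isDivFree_perturbation 𝔚 ht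
  have hU := h.uniqueDiffOn t ht
  -- (1) time derivative of the sum
  have e1 : timeDerivWithin (Icc 0 S.T) (BDSV.newVelocity P S 𝔚 η D) t x =
      timeDerivWithin (Icc 0 S.T) v t x + timeDerivWithin (Icc 0 S.T) w t x :=
    ((h.vbar.hasDerivWithinAt_slice ht x).add (hw.hasDerivWithinAt_slice ht x)).derivWithin hU
  -- (2) the convective term
  have e2 : convect (BDSV.newVelocity P S 𝔚 η D t) (BDSV.newVelocity P S 𝔚 η D t) x =
      convect (v t) (v t) x + convect (w t) (v t) x + (convect (v t) (w t) x + convect (w t) (w t) x) := by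
    show Torus.fderiv (v t + w t) x (v t x + w t x) = _
    rw [fderiv_add hvt.isContDiff_one hwt.isContDiff_one, FunLike.coe_add, Pi.add_apply, map_add, map_add]
    rfl
  -- (3) the pressure gradient
  have e3 : gradient (BDSV.newPressure P S η t) x = gradient (S.pbar t) x - gradient ρtot x := by
    have hp' : IsSmooth (BDSV.newPressure P S η t) := h.newPressure.isSmooth_slice ht
    rw [gradient_eq_sum_partialDeriv hp'.isContDiff_one, gradient_eq_sum_partialDeriv hpt.isContDiff_one,
      gradient_eq_sum_partialDeriv hρtot.isContDiff_one, ← Finset.sum_sub_distrib]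
    refine Finset.sum_congr rfl fun k _ => ?_
    rw [← sub_smul]
    congr 1
    have hpc : IsSmooth (fun y => S.pbar t y + rhoQ P S t) := hpt.add (isSmooth_const _)
    show partialDeriv k (fun y => S.pbar t y + rhoQ P S t - ρtot y) x = _
    rw [partialDeriv_sub_at hpc.isContDiff_one hρtot.isContDiff_one,
      partialDeriv_add_apply hpt.isContDiff_one (isSmooth_const (rhoQ P S t)).isContDiff_one,
      partialDeriv_const_apply, add_zero]
  -- (4) the divergence of the oscillation tensor
  have hA : IsSmooth (fun y j => w t y j • w t y) := contDiff_pi.2 fun j => (hwt.apply j).smul' hwt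
  have hstress : BDSV.stressSum P S η t = fun y j => ρtot y • EuclideanSpace.single j (1 : ℝ) - S.Rbar t y j := by
    funext y j
    rw [stressSum_apply, hsupp t ht y j]
  have hE : IsSmooth (fun _ : 𝕋³ => fun j : Fin 3 => EuclideanSpace.single j (1 : ℝ)) :=
    isSmooth_const _
  have hB1 : IsSmooth (fun y j => ρtot y • EuclideanSpace.single j (1 : ℝ)) := hρtot.smul' hE
  have hB : IsSmooth (BDSV.stressSum P S η t) := by
    rw [hstress]
    exact (hρtot.smul' hE).sub hRt
  have e4 : Torus.tensorDivergence (fun y j => w t y j • w t y - BDSV.stressSum P S η t y j) x =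
      convect (w t) (w t) x - (gradient ρtot x - Torus.tensorDivergence (S.Rbar t) x) := by
    rw [tensorDivergence_sub hA hB, tensorDivergence_smul_self hwt hdivw, hstress,
      tensorDivergence_sub hB1 hRt, tensorDivergence_smul_single hρtot]
  -- (5) assemble
  have hmom := hER.momentum t ht x
  rw [h.tensorDivergence_newStress 𝔚 hER.divFree ht, BDSV.stressSource, e4, e1, e2, e3]
  rw [← hmom]
  abel

/-- **The new triple is an Euler–Reynolds triple on `[0,T] × T³`** (BDSV §5.4), given the
smoothness/positivity data, the Euler–Reynolds equations of the glued triple and the support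
identity `(∑_i η_i²) R̊̄_q = R̊̄_q`. [cite: BuckmasterEtAl2018, §5.4 (5.23)–(5.24)] -/
theorem isEulerReynoldsOn_newTriple (hER : Torus.IsEulerReynoldsOn (Icc 0 S.T) S.vbar S.pbar S.Rbar)
    (hsupp : ∀ t ∈ Icc 0 S.T, ∀ (x : 𝕋³) (j : Fin 3),
      (∑ i ∈ Finset.range (cutoffCount S.T (P.τ S.q)), η i t x ^ 2) • S.Rbar t x j = S.Rbar t x j) :
    Torus.IsEulerReynoldsOn (Icc 0 S.T) (BDSV.newVelocity P S 𝔚 η D) (BDSV.newPressure P S η)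
      (BDSV.newStress P S 𝔚 η D) where
  smooth_velocity := h.newVelocity 𝔚
  smooth_pressure := h.newPressure
  smooth_stress := h.newStress 𝔚
  momentum t ht x := h.momentum_newTriple 𝔚 hER hsupp ht x
  divFree t ht x := by
    show divergence (fun y => S.vbar t y + BDSV.perturbation P S 𝔚 η D t y) x = 0
    rw [divergence_add (h.vbar.isSmooth_slice ht) ((h.perturbation 𝔚).isSmooth_slice ht),
      hER.divFree t ht x, h.isDivFree_perturbation 𝔚 ht x, add_zero]
  symm t ht x i j := Torus.antidivergence_symm ((h.stressSource 𝔚).isSmooth_slice ht) x i j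
  traceFree t ht x := Torus.antidivergence_trace (by simp) ((h.stressSource 𝔚).isSmooth_slice ht) x
  hasZeroMean_pressure t ht := h.hasZeroMean_newPressure hER.hasZeroMean_pressure ht

end SmoothData

end EulerReynolds

/-! ## Discharge of F₅: `BDSV.newTriple_isEulerReynolds` -/

section Discharge

open Torus

/-- **Lemma 5.4 (5.15), lower bound, parameter part**: for `α < 2βb(b-1)` and `a` large,
`2δ_{q+2} ≤ δ_{q+1} λ_q^{-α}` for all `q` (so that, with the energy gap (5.2), `ρ_q ≥ δ_{q+2}/6 > 0`).
[cite: BuckmasterEtAl2018, Lemma 5.4 (5.15)] -/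
theorem exists_threshold_amp_succ_succ {β b α : ℝ} (hb : 1 < b) (hαb : α < 2 * β * b * (b - 1)) :
    ∃ a₁ : ℝ, 1 < a₁ ∧ ∀ a : ℝ, a₁ ≤ a → ∀ q : ℕ,
      2 * amp β a b (q + 2) ≤ amp β a b (q + 1) * freq a b q ^ (-α) := by
  have hE : α + b * (2 * β) + b ^ 2 * (-2 * β) < 0 := by nlinarith
  obtain ⟨a₁, ha₁, h⟩ := exists_freq_triple_le hb.le hE 2
  refine ⟨a₁, ha₁, fun a ha q => ?_⟩
  have ha1 : (1 : ℝ) ≤ a := ha₁.le.trans ha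
  have h0 := freq_pos (b := b) ha1 q
  have h1 := freq_pos (b := b) ha1 (q + 1)
  have hq := h a ha q
  have e0 : freq a b q ^ α * freq a b q ^ (-α) = 1 := by
    rw [← Real.rpow_add h0, add_neg_cancel, Real.rpow_zero]
  have e1 : freq a b (q + 1) ^ (2 * β) * freq a b (q + 1) ^ (-2 * β) = 1 := by
    rw [← Real.rpow_add h1, show 2 * β + -2 * β = 0 by ring, Real.rpow_zero]
  have hpos : 0 < freq a b q ^ (-α) * freq a b (q + 1) ^ (-2 * β) := by positivity
  have key := mul_le_mul_of_nonneg_right hq hpos.le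
  rw [one_mul] at key
  unfold amp
  calc 2 * freq a b (q + 2) ^ (-2 * β)
      = 2 * (freq a b q ^ α * freq a b (q + 1) ^ (2 * β) * freq a b (q + 2) ^ (-2 * β)) *
          (freq a b q ^ (-α) * freq a b (q + 1) ^ (-2 * β)) := by
        rw [show 2 * (freq a b q ^ α * freq a b (q + 1) ^ (2 * β) * freq a b (q + 2) ^ (-2 * β)) *
            (freq a b q ^ (-α) * freq a b (q + 1) ^ (-2 * β)) =
            2 * freq a b (q + 2) ^ (-2 * β) * (freq a b q ^ α * freq a b q ^ (-α)) *
              (freq a b (q + 1) ^ (2 * β) * freq a b (q + 1) ^ (-2 * β)) by ring, e0, e1]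
        ring
    _ ≤ freq a b q ^ (-α) * freq a b (q + 1) ^ (-2 * β) := key
    _ = freq a b (q + 1) ^ (-2 * β) * freq a b q ^ (-α) := mul_comm _ _

/-- **Discharge of F₅** (`BDSV.newTriple_isEulerReynolds`, BDSV §5.4): the new triple
`(v̄_q + w_{q+1}, p_{q+1}, R̊_{q+1})` of (5.28), (5.23) solves the Euler–Reynolds system on
`[0,T] × T³`, for `α < α₀ = βb(b-1)` and `a` beyond the threshold of
`BDSV.exists_threshold_amp_succ_succ` (which makes `ρ_q > 0`).
[cite: BuckmasterEtAl2018, §5.4 (5.23)–(5.24)] -/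
theorem newTriple_isEulerReynolds_holds : newTriple_isEulerReynolds := by
  intro 𝔚 c₀ hc₀ Cη β hβ hβ3 b hb hbβ
  refine ⟨β * b * (b - 1), by nlinarith [mul_pos hβ (by linarith : (0 : ℝ) < b)], ?_⟩
  intro α hα hαlt
  refine ⟨0, fun Cin C₀ => ?_⟩
  have hαb : α < 2 * β * b * (b - 1) := by nlinarith [mul_pos hβ (by linarith : (0 : ℝ) < b)]
  obtain ⟨a₁, ha₁, hpar⟩ := exists_threshold_amp_succ_succ hb hαb
  refine ⟨a₁, ha₁, fun a ha S H 𝒟 => ?_⟩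
  have ha1 : (1 : ℝ) ≤ a := ha₁.le.trans ha
  have hτ : 0 < Params.τ ⟨β, α, a, b⟩ S.q := glueScale_pos ha1 S.q
  -- the smoothness / positivity data
  have hSD : SmoothData ⟨β, α, a, b⟩ S 𝒟.cut.η 𝒟.D :=
    { pos_T := H.pos_T
      e := H.profile.smooth
      vbar := H.eulerReynolds.smooth_velocity
      pbar := H.eulerReynolds.smooth_pressure
      Rbar := H.eulerReynolds.smooth_stress
      eta := 𝒟.cut.smooth
      disp := fun i => (𝒟.flow i).smooth
      rho_pos := fun t ht => by
        have h2 := hpar a ha S.q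
        have hgap := (H.energy_gap t ht).1
        have hδ : 0 < amp β a b (S.q + 2) := amp_pos ha1 _
        show 0 < (S.e t - amp β a b (S.q + 2) / 2 - ∫ x, ‖S.vbar t x‖ ^ 2) / 3
        nlinarith
      mass_pos := fun t ht => lt_of_lt_of_le hc₀ (𝒟.cut.sum_sq_ge t ht) }
  have hsupp : ∀ t ∈ Icc 0 S.T, ∀ (x : 𝕋³) (j : Fin 3),
      (∑ i ∈ Finset.range (cutoffCount S.T (Params.τ ⟨β, α, a, b⟩ S.q)), 𝒟.cut.η i t x ^ 2) •
        S.Rbar t x j = S.Rbar t x j :=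
    fun t ht x j => sum_eta_sq_smul_Rbar hτ 𝒟.cut H.stress_support ht x j
  exact hSD.isEulerReynoldsOn_newTriple 𝔚 H.eulerReynolds hsupp

end Discharge

end BDSV

end Literature.Analysis.FluidPDE
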